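import Summits.HubbardSuperconductivity.HubbardLadder.Bounds.KinWeightCeilingTPrime
import Literature.MathematicalPhysics.QuantumLattice.HubbardNNNHoppingFluxThermal
import Literature.MathematicalPhysics.QuantumLattice.TransverseWardIdentity
import Literature.MathematicalPhysics.QuantumLattice.HubbardAtomicLimit
import HarnessLib

/-!
# Thermal stiffness ceiling for the `t–t'` Hubbard torus (pub-hubbard BOUNDS, `T > 0`)

HONEST FRAMING: ladder R1–R4 with certified numbers; no claim on H/H₀. These are rigorous bounds
for a MODEL CLASS (the `t–t'` Hubbard torus), no materials claim.

Cell tree `Summits/HubbardSuperconductivity/HubbardLadder/Bounds/` (programme-internal statements;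
nothing here is a cited Literature fact). The positive-temperature counterpart of
`StiffnessCeilingTPrime.lean` (`HalfBathtubStiffnessBoundTT'`, `T = 0`). The Literature side is
LANDED: `Literature/…/HubbardNNNHoppingFluxThermal.lean` proves, for every `L ≥ 3`, `t'`, `U`, `β`
and every coordinate sector `p`, the thermal f-sum bound and its stiffness corollary
`thermalStiffnessTT'_mul_sq_le_kinetic` (`β ρ_s θ² ≤ log Z_p(0) - log Z_p(θ)` on `|θ| ≤ θ₀` ⇒
`ρ_s L² ≤ ½ Re⟨kinOpTT'⟩_{β,p} = ⟨K_x + t' K_d⟩_{β,p}`).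

This file PROVES bounds.tex Thm 1 at `T > 0` for the canonical `(N_L, S^z = 0)` ensembles
(all nodes closed, standard axioms):
* the sector predicate is written inline, in the tree's convention (route `LogColdTorus`):
  `p s := s.card = N_L ∧ 2 · #{i ∈ s : spin i = 0} = N_L`, `N_L = 2⌊(1-δ)L²/2⌋`, `δ ≥ -1`;
* `ThermalKinWeightCeilingTT'` — the thermal `e₁`-kinetic ceiling
  `½ Re⟨kinOpTT'⟩_{β,p} ≤ ν N_L/2 + Σ_k (cos k₁ + cos k₂ + 4t' cos k₁ cos k₂ - ν)⁺` for every `ν`,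
  PROVED (`thermalKinWeightCeilingTT'_holds`; bounds.tex Cor. 2.2(ii)+(iii) at `T > 0`): the
  bathtub defect `2ν N + 4B·1 - (K + Γ(r) K Γ(r)ᴴ)` (`K = kinOpTT'`, `B = Σ_k ttBathtub`, `Γ(r)`
  the second-quantised lattice rotation) is positive semidefinite on Fock space by the
  every-state summed bathtub bound `kinWeightTT'_sum_le` (`K_x + K_y + 2t'K_d ≤ ν⟨N⟩ + 2B‖ψ‖²`;
  the form of `Γ K Γᴴ` is `2(K_y + t'K_d)`), hence has non-negative sector Gibbs expectation;
  `N|_p = N_L·1`, `⟨1⟩ = 1`; and `⟨(Γ K Γᴴ)|_p⟩_{β,p} = ⟨K|_p⟩_{β,p}` because `Γ(r)` commutes with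
  `H` (`fockMapOp_rot_mul_hubbardTorusTT'`) and does not connect the sector to its complement
  (`gibbsState_toBlock_conj_of_sector`: covariance of Gibbs states, `gibbsState_conj_eq`);
* `ThermalHalfBathtubStiffnessBoundTT'` — the thermal flux-stiffness ceiling
  `ρ_s L² ≤ ν N_L/2 + Σ_k (…)⁺` for every `ν` (i.e. `ρ_s ≤ s_L(n,t')/2`, EXTREMISERS.md), PROVED
  (`thermalHalfBathtubStiffnessBoundTT'_holds` = landed floor ∘ ceiling); at `t' = 0` it is the
  nearest-neighbour thermal bound `ρ_s ≤ s_L(n)/2` (`hubbardTorusTT'Flux_tPrime_zero`).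

References: Paramekanti–Trivedi–Randeria PRB 57 (1998) 11639, eq. (3), §IV; Hazra–Verma–Randeria
PRX 9 (2019) 031049, eqs. (2)–(6); bounds.tex Thm 1, Cor. 2.2.
-/

noncomputable section

namespace Summit.HubbardSuperconductivity.HubbardLadder.Bounds

open Matrix Literature.MathematicalPhysics.QuantumLattice
  Literature.MathematicalPhysics.QuantumFieldTheory Literature.Probability.LatticeModels
open scoped ComplexConjugate ComplexOrder

/-- Shortcut instance: decidable equality of occupation sets of the fermionic torus (instance
search does not close `DecidableEq {a // p a}` for coordinate sectors `p` without it; on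
`Orb (FermionTorus 2 L)` the `Lex`/`Pi` instance and the linear-order one differ, cf.
`fockMapOp_d4Orb_mem_unitaryGroup`). All identity matrices below use this instance. -/
instance instDecidableEqFinsetOrbFermionTorus (L : ℕ) :
    DecidableEq (Finset (Orb (FermionTorus 2 L))) :=
  inferInstance

/-! ### The statements -/

/-- **The thermal `e₁`-kinetic ceiling for the `t–t'` class.** For `L ≥ 3`, every `t'`, `U`,
`β`, `δ ≥ -1`, with `N_L = 2⌊(1-δ)L²/2⌋` and `p` the `(N_L, S^z = 0)` coordinate sector
(`|s| = N_L`, `2 · #{i ∈ s : spin i = 0} = N_L`, the convention of route `LogColdTorus`):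
`½ Re⟨kinOpTT'⟩_{β,p} ≤ ν N_L/2 + Σ_k (cos(2πk₁/L) + cos(2πk₂/L) + 4t' cos(2πk₁/L)cos(2πk₂/L) - ν)⁺`
for every `ν` — the Gibbs-state version of `GroundStateKinWeightCeilingTT'`. PROVED below
(`thermalKinWeightCeilingTT'_holds`). bounds.tex Cor. 2.2(iii) at `T > 0`. -/
@[conjecture] def ThermalKinWeightCeilingTT' : Prop :=
  ∀ (L : ℕ) [NeZero L], 3 ≤ L → ∀ (t' U β δ : ℝ), -1 ≤ δ →
    let p : Finset (Orb (FermionTorus 2 L)) → Prop := fun s =>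
      s.card = 2 * ⌊(1 - δ) * (L : ℝ) ^ 2 / 2⌋₊ ∧
        2 * (s.filter fun i => (ofLex i).2 = 0).card = 2 * ⌊(1 - δ) * (L : ℝ) ^ 2 / 2⌋₊
    ∀ ν : ℝ,
      (gibbsState β ((hubbardTorusTT' L 1 t' U).toBlock p p) ((kinOpTT' L t').toBlock p p)).re / 2 ≤
        ν * ((2 * ⌊(1 - δ) * (L : ℝ) ^ 2 / 2⌋₊ : ℕ) : ℝ) / 2 +
          ∑ k : TorusSite 2 L,
            max (Real.cos (latticeMomentum L k 0) + Real.cos (latticeMomentum L k 1) +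
              4 * t' * (Real.cos (latticeMomentum L k 0) * Real.cos (latticeMomentum L k 1)) - ν) 0

/-- **The thermal flux-stiffness ceiling for the `t–t'` class** (bounds.tex Thm 1(b)+(c) at
`T > 0`; HVR19 eq. (3) in the canonical `(N_L, S^z = 0)` ensemble with the sharp bathtub
constant): for `L ≥ 3`, every `t'`, `U`, `δ ≥ -1`, `β, ρ_s, θ₀ > 0`, if the sector free energy is
stiff in the flux, `β ρ_s θ² ≤ log Z_p(0) - log Z_p(θ)` for `|θ| ≤ θ₀` (`p` the `(N_L, S^z = 0)`
coordinate sector, `Z_p` the `Matrix.partitionFn` of the `Matrix.toBlock p p` compression of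
`hubbardTorusTT'Flux L t' U θ`), then `ρ_s L² ≤ ν N_L/2 + Σ_k (…)⁺` for every `ν`, i.e.
`ρ_s ≤ s_L(n, t')/2` (EXTREMISERS.md). PROVED below
(`thermalHalfBathtubStiffnessBoundTT'_holds`). -/
@[conjecture] def ThermalHalfBathtubStiffnessBoundTT' : Prop :=
  ∀ (L : ℕ) [NeZero L], 3 ≤ L → ∀ (t' U δ β ρs θ₀ : ℝ), -1 ≤ δ → 0 < β → 0 < ρs → 0 < θ₀ →
    let p : Finset (Orb (FermionTorus 2 L)) → Prop := fun s =>
      s.card = 2 * ⌊(1 - δ) * (L : ℝ) ^ 2 / 2⌋₊ ∧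
        2 * (s.filter fun i => (ofLex i).2 = 0).card = 2 * ⌊(1 - δ) * (L : ℝ) ^ 2 / 2⌋₊
    (∀ θ : ℝ, |θ| ≤ θ₀ → β * ρs * θ ^ 2 ≤
        Real.log (partitionFn β ((hubbardTorusTT'Flux L t' U 0).toBlock p p)).re -
          Real.log (partitionFn β ((hubbardTorusTT'Flux L t' U θ).toBlock p p)).re) →
    ∀ ν : ℝ, ρs * (L : ℝ) ^ 2 ≤
      ν * ((2 * ⌊(1 - δ) * (L : ℝ) ^ 2 / 2⌋₊ : ℕ) : ℝ) / 2 +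
        ∑ k : TorusSite 2 L,
          max (Real.cos (latticeMomentum L k 0) + Real.cos (latticeMomentum L k 1) +
            4 * t' * (Real.cos (latticeMomentum L k 0) * Real.cos (latticeMomentum L k 1)) - ν) 0

/-- **Reduction: the thermal kinetic ceiling implies the thermal stiffness ceiling** — the landed
thermal f-sum floor `thermalStiffnessTT'_mul_sq_le_kinetic`
(`Literature/…/HubbardNNNHoppingFluxThermal.lean`) composed with `ThermalKinWeightCeilingTT'`. -/
theorem thermalHalfBathtubStiffnessBoundTT'_of_ceiling (hC : ThermalKinWeightCeilingTT') :
    ThermalHalfBathtubStiffnessBoundTT' := by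
  intro L _ hL t' U δ β ρs θ₀ hδ hβ hρs hθ₀
  dsimp only
  intro hst ν
  have h := hC L hL t' U β δ hδ
  dsimp only at h
  exact (thermalStiffnessTT'_mul_sq_le_kinetic hL t' U hβ hρs hθ₀ _ hst).trans (h ν)

/-! ### Compressions to a coordinate sector commute with sector-respecting symmetries -/

section Block

variable {m : Type*} [Fintype m]

/-- If `R` does not connect the coordinate sector `p` to its complement, compression to `p`
commutes with conjugation by `R`: `(R A Rᴴ)|_p = R|_p A|_p (R|_p)ᴴ`. -/
theorem toBlock_conj_of_sector (p : m → Prop) [DecidablePred p] (R A : Matrix m m ℂ)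
    (hR : ∀ s t, R s t ≠ 0 → (p s ↔ p t)) :
    (R * A * Rᴴ).toBlock p p = R.toBlock p p * A.toBlock p p * (R.toBlock p p)ᴴ := by
  have h1 : R.toBlock p (fun i => ¬p i) = 0 := by
    ext i j
    rw [toBlock_apply, Matrix.zero_apply]
    by_contra h
    exact j.2 ((hR _ _ h).1 i.2)
  have h2 : Rᴴ.toBlock (fun i => ¬p i) p = 0 := by
    ext i j
    rw [toBlock_apply, conjTranspose_apply, Matrix.zero_apply, star_eq_zero]
    by_contra h
    exact i.2 ((hR _ _ h).1 j.2)
  have h3 : Rᴴ.toBlock p p = (R.toBlock p p)ᴴ := by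
    ext i j
    rfl
  rw [toBlock_mul_eq_add p p p (R * A) Rᴴ, h2, Matrix.mul_zero, add_zero,
    toBlock_mul_eq_add p p p R A, h1, Matrix.zero_mul, add_zero, h3]

variable [DecidableEq m]

/-- **Sector Gibbs expectations are invariant under a sector-respecting symmetry of `H`**: if
`R Rᴴ = 1`, `R H = H R` and `R` does not connect `p` to its complement, then
`⟨(R A Rᴴ)|_p⟩_{β, H|_p} = ⟨A|_p⟩_{β, H|_p}` (the compression `R|_p` is a unitary commuting with
`H|_p`; covariance of Gibbs states `gibbsState_conj_eq`). -/
theorem gibbsState_toBlock_conj_of_sector (p : m → Prop) [DecidablePred p] {R H : Matrix m m ℂ}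
    (hR : ∀ s t, R s t ≠ 0 → (p s ↔ p t)) (hRR : R * Rᴴ = 1) (hcomm : R * H = H * R) (β : ℝ)
    (A : Matrix m m ℂ) :
    gibbsState β (H.toBlock p p) ((R * A * Rᴴ).toBlock p p) =
      gibbsState β (H.toBlock p p) (A.toBlock p p) := by
  have hWW : R.toBlock p p * (R.toBlock p p)ᴴ = 1 := by
    have h := toBlock_conj_of_sector p R 1 hR
    rw [Matrix.mul_one, hRR, toBlock_one_self, Matrix.mul_one] at h
    exact h.symm
  have hW'W : (R.toBlock p p)ᴴ * R.toBlock p p = 1 := mul_eq_one_comm.1 hWW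
  have hunit : IsUnit (R.toBlock p p) := ⟨⟨_, _, hWW, hW'W⟩, rfl⟩
  have hinv : (R.toBlock p p)⁻¹ = (R.toBlock p p)ᴴ := Matrix.inv_eq_right_inv hWW
  have hH : (R * H * Rᴴ).toBlock p p = H.toBlock p p := by
    rw [hcomm, Matrix.mul_assoc, hRR, Matrix.mul_one]
  calc gibbsState β (H.toBlock p p) ((R * A * Rᴴ).toBlock p p)
      = gibbsState β (R.toBlock p p * H.toBlock p p * (R.toBlock p p)⁻¹)
          (R.toBlock p p * A.toBlock p p * (R.toBlock p p)⁻¹) := by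
        rw [hinv, ← toBlock_conj_of_sector p R A hR, ← toBlock_conj_of_sector p R H hR, hH]
    _ = gibbsState β (H.toBlock p p) (A.toBlock p p) := gibbsState_conj_eq β hunit _ _

end Block

/-! ### Torus bookkeeping: spin labels, the `(2n, S^z = 0)` sector, the number operator -/

variable {L : ℕ}

/-- Relabelling an occupation set along a site bijection keeps the number of spin-`0` orbitals. -/
theorem card_filter_spin_zero_finsetCongr (f : FermionTorus 2 L ≃ FermionTorus 2 L)
    (t : Finset (Orb (FermionTorus 2 L))) :
    (((Orb.mapEquiv f).finsetCongr t).filter fun i => (ofLex i).2 = 0).card =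
      (t.filter fun i => (ofLex i).2 = 0).card := by
  rw [Equiv.finsetCongr_apply, Finset.filter_map, Finset.card_map]
  exact congrArg Finset.card (Finset.filter_congr fun i _ => Iff.rfl)

/-- The up electrons of `α↑ ∪ β↓` are `α↑`. -/
theorem filter_spin_zero_pairSet_eq {Λ : Type*} [LinearOrder Λ] [Fintype Λ] (α β : Finset Λ) :
    (pairSet α β).filter (fun i => (ofLex i).2 = 0) = pairSet α ∅ := by
  ext i
  simp only [Finset.mem_filter, mem_pairSet, Finset.notMem_empty, and_false, or_false]
  constructor
  · rintro ⟨h | h, h0⟩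
    · exact h
    · exact absurd (h.1.symm.trans h0) (by decide)
  · intro h
    exact ⟨Or.inl h, h.1⟩

/-- The `(2n, S^z = 0)` coordinate sector of the `L × L` torus is non-empty for `n ≤ L²`
(take `α↑ ∪ α↓` for an `n`-set `α` of sites). -/
theorem nonempty_spinZeroSector {n : ℕ} (hn : n ≤ L ^ 2) :
    Nonempty {s : Finset (Orb (FermionTorus 2 L)) //
      s.card = 2 * n ∧ 2 * (s.filter fun i => (ofLex i).2 = 0).card = 2 * n} := by
  have hle : n ≤ (Finset.univ : Finset (FermionTorus 2 L)).card := by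
    rw [Finset.card_univ, NoGo.card_fermionTorus_two]; exact hn
  obtain ⟨α, -, hα⟩ := Finset.exists_subset_card_eq hle
  refine ⟨⟨pairSet α α, ?_, ?_⟩⟩
  · rw [card_pairSet, hα, two_mul]
  · rw [filter_spin_zero_pairSet_eq, card_pairSet, hα, Finset.card_empty, add_zero]

/-- The total number operator of the torus is Hermitian (diagonal with natural entries). -/
theorem isHermitian_totalNumber_torus : Matrix.IsHermitian
    (totalNumber : Matrix (Finset (Orb (FermionTorus 2 L))) (Finset (Orb (FermionTorus 2 L))) ℂ) :=
  by
  rw [totalNumber_eq_diagonal_card]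
  refine Matrix.IsHermitian.ext fun i j => ?_
  simp only [diagonal, of_apply]
  by_cases h : i = j
  · subst h
    simp
  · have h' : j ≠ i := Ne.symm h
    simp [h, h']

variable [NeZero L]

/-- **The rotation `Γ(r)` does not connect an `(N, S^z = 0)` coordinate sector to its
complement**: a non-zero entry `Γ(r)_{s,t}` forces `s = r·t` (`Γ(r)` is the signed permutation
matrix `relabelMatrix`), and `r·t` has as many orbitals, and as many spin-`0` orbitals, as `t`. -/
theorem sector_iff_of_fockMapOp_rot_ne_zero (N : ℕ) {s t : Finset (Orb (FermionTorus 2 L))}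
    (h : fockMapOp (d4Orb (DihedralGroup.r 1 : DihedralGroup 4)) s t ≠ 0) :
    (s.card = N ∧ 2 * (s.filter fun i => (ofLex i).2 = 0).card = N) ↔
      (t.card = N ∧ 2 * (t.filter fun i => (ofLex i).2 = 0).card = N) := by
  rw [d4Orb_eq_coe_mapEquiv, fockMapOp_equiv] at h
  have hst : s = (Orb.mapEquiv (FermionTorus.ofTorusEquiv
      (d4SiteEquiv (L := L) (DihedralGroup.r 1 : DihedralGroup 4)))).finsetCongr t := by
    by_contra hne
    apply h
    unfold relabelMatrix
    exact if_neg hne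
  subst hst
  rw [card_filter_spin_zero_finsetCongr, Equiv.finsetCongr_apply, Finset.card_map]

/-- `Γ(r) Γ(r)ᴴ = 1` for the file's `DecidableEq` instance (`fockMapOp_d4Orb_mem_unitaryGroup`). -/
theorem fockMapOp_rot_mul_conjTranspose :
    fockMapOp (d4Orb (DihedralGroup.r 1 : DihedralGroup 4)) *
        (fockMapOp (d4Orb (L := L) (DihedralGroup.r 1 : DihedralGroup 4)))ᴴ = 1 := by
  have h := fockMapOp_d4Orb_mem_unitaryGroup (L := L) (DihedralGroup.r 1 : DihedralGroup 4)
  rwa [Matrix.mem_unitaryGroup_iff, star_eq_conjTranspose] at h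

/-! ### The bathtub defect is positive semidefinite -/

/-- `Re⟨ψ, kinOpTT' ψ⟩ = 2 (K_x(ψ) + t' K_diag(ψ))` in the tree's kinetic weights. -/
theorem re_kinOpTT'_form (t' : ℝ) (ψ : Fock (Orb (FermionTorus 2 L))) :
    (star ψ ⬝ᵥ (kinOpTT' L t' *ᵥ ψ)).re = 2 * (kinWeightDir 0 ψ + t' * kinWeightDiag ψ) := by
  rw [re_star_dotProduct_kinOpTT'_mulVec, kinWeightDiag, Fin.sum_univ_two]
  rfl

/-- **The rotated kinetic operator measures the `e₂`-weight**:
`Re⟨φ, Γ(r) kinOpTT' Γ(r)ᴴ φ⟩ = 2 (K_y(φ) + t' K_diag(φ))` (`kinWeightDir_one_rot` and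
`kinWeightDiag_rot` at `Γ(r)ᴴ φ`, `Γ Γᴴ = 1`). -/
theorem re_rot_kinOpTT'_form (t' : ℝ) (φ : Fock (Orb (FermionTorus 2 L))) :
    (star φ ⬝ᵥ ((fockMapOp (d4Orb (DihedralGroup.r 1 : DihedralGroup 4)) * kinOpTT' L t' *
        (fockMapOp (d4Orb (DihedralGroup.r 1 : DihedralGroup 4)))ᴴ) *ᵥ φ)).re =
      2 * (kinWeightDir 1 φ + t' * kinWeightDiag φ) := by
  have hφ : fockMapOp (d4Orb (DihedralGroup.r 1 : DihedralGroup 4)) *ᵥ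
      ((fockMapOp (d4Orb (DihedralGroup.r 1 : DihedralGroup 4)))ᴴ *ᵥ φ) = φ := by
    rw [mulVec_mulVec, fockMapOp_rot_mul_conjTranspose, one_mulVec]
  have hform : star φ ⬝ᵥ ((fockMapOp (d4Orb (DihedralGroup.r 1 : DihedralGroup 4)) *
      kinOpTT' L t' * (fockMapOp (d4Orb (DihedralGroup.r 1 : DihedralGroup 4)))ᴴ) *ᵥ φ) =
      star ((fockMapOp (d4Orb (DihedralGroup.r 1 : DihedralGroup 4)))ᴴ *ᵥ φ) ⬝ᵥ
        (kinOpTT' L t' *ᵥ ((fockMapOp (d4Orb (DihedralGroup.r 1 : DihedralGroup 4)))ᴴ *ᵥ φ)) := by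
    rw [← mulVec_mulVec, ← mulVec_mulVec,
      dotProduct_mulVec (star φ) (fockMapOp (d4Orb (DihedralGroup.r 1 : DihedralGroup 4))),
      star_mulVec ((fockMapOp (d4Orb (DihedralGroup.r 1 : DihedralGroup 4)))ᴴ) φ,
      conjTranspose_conjTranspose]
  rw [hform, re_kinOpTT'_form,
    ← kinWeightDir_one_rot ((fockMapOp (d4Orb (DihedralGroup.r 1 : DihedralGroup 4)))ᴴ *ᵥ φ),
    ← kinWeightDiag_rot ((fockMapOp (d4Orb (DihedralGroup.r 1 : DihedralGroup 4)))ᴴ *ᵥ φ), hφ]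

/-- **The bathtub defect is positive semidefinite** (`L ≥ 2`): for every `ν`,
`2ν N + 4B·1 - (K + Γ(r) K Γ(r)ᴴ) ≥ 0` on Fock space, `K = kinOpTT' L t'`,
`B = Σ_k (cos k₁ + cos k₂ + 4t' cos k₁ cos k₂ - ν)⁺` — the operator form of the every-state
summed bathtub bound `kinWeightTT'_sum_le` (`K_x + K_y + 2t' K_diag ≤ ν Re⟨ψ,Nψ⟩ + 2B‖ψ‖²`). -/
theorem posSemidef_bathtubDefect (hL : 2 ≤ L) (t' ν : ℝ) :
    (((2 * ν : ℝ) : ℂ) • (totalNumber : Matrix (Finset (Orb (FermionTorus 2 L))) _ ℂ) +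
        ((4 * ∑ k : TorusSite 2 L, ttBathtub t' ν k : ℝ) : ℂ) •
          (1 : Matrix (Finset (Orb (FermionTorus 2 L))) _ ℂ) -
      (kinOpTT' L t' + fockMapOp (d4Orb (DihedralGroup.r 1 : DihedralGroup 4)) * kinOpTT' L t' *
        (fockMapOp (d4Orb (DihedralGroup.r 1 : DihedralGroup 4)))ᴴ)).PosSemidef := by
  have hM : (((2 * ν : ℝ) : ℂ) • (totalNumber : Matrix (Finset (Orb (FermionTorus 2 L))) _ ℂ) +
        ((4 * ∑ k : TorusSite 2 L, ttBathtub t' ν k : ℝ) : ℂ) •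
          (1 : Matrix (Finset (Orb (FermionTorus 2 L))) _ ℂ) -
      (kinOpTT' L t' + fockMapOp (d4Orb (DihedralGroup.r 1 : DihedralGroup 4)) * kinOpTT' L t' *
        (fockMapOp (d4Orb (DihedralGroup.r 1 : DihedralGroup 4)))ᴴ)).IsHermitian :=
    ((isHermitian_ofReal_smul isHermitian_totalNumber_torus _).add
      (isHermitian_ofReal_smul isHermitian_one _)).sub
      ((isHermitian_kinOpTT' t').add
        (isHermitian_mul_mul_conjTranspose _ (isHermitian_kinOpTT' t')))
  refine PosSemidef.of_dotProduct_mulVec_nonneg hM fun φ => ?_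
  have him := hM.im_star_dotProduct_mulVec_self φ
  have hre : 0 ≤ (star φ ⬝ᵥ ((((2 * ν : ℝ) : ℂ) •
        (totalNumber : Matrix (Finset (Orb (FermionTorus 2 L))) _ ℂ) +
        ((4 * ∑ k : TorusSite 2 L, ttBathtub t' ν k : ℝ) : ℂ) •
          (1 : Matrix (Finset (Orb (FermionTorus 2 L))) _ ℂ) -
      (kinOpTT' L t' + fockMapOp (d4Orb (DihedralGroup.r 1 : DihedralGroup 4)) * kinOpTT' L t' *
        (fockMapOp (d4Orb (DihedralGroup.r 1 : DihedralGroup 4)))ᴴ)) *ᵥ φ)).re := by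
    rw [sub_mulVec, add_mulVec, add_mulVec, smul_mulVec, smul_mulVec, one_mulVec,
      dotProduct_sub, dotProduct_add, dotProduct_add, dotProduct_smul, dotProduct_smul,
      Complex.sub_re, Complex.add_re, Complex.add_re, smul_eq_mul, smul_eq_mul,
      Complex.re_ofReal_mul, Complex.re_ofReal_mul, re_kinOpTT'_form, re_rot_kinOpTT'_form]
    have h := kinWeightTT'_sum_le hL t' ν φ
    linarith
  exact Complex.nonneg_iff.2 ⟨hre, him.symm⟩

/-! ### The thermal kinetic ceiling -/

/-- **Thermal `e₁`-kinetic ceiling on a rotation-compatible `N`-particle sector** (`L ≥ 3`):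
for every non-empty coordinate sector `p` of `N`-particle occupation sets which the rotation
`Γ(r)` does not connect to its complement (e.g. the `(N, S^z = M)` sectors),
`½ Re⟨kinOpTT'|_p⟩_{β, H|_p} ≤ ν N/2 + Σ_k (cos k₁ + cos k₂ + 4t' cos k₁ cos k₂ - ν)⁺` for every `ν`
(`H = hubbardTorusTT' L 1 t' U`): Gibbs positivity on the compressed bathtub defect
(`posSemidef_bathtubDefect`), `N|_p = N·1`, `⟨1⟩ = 1`, and rotation invariance
`⟨(Γ K Γᴴ)|_p⟩ = ⟨K|_p⟩` (`gibbsState_toBlock_conj_of_sector`). -/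
theorem re_gibbsState_kinOpTT'_toBlock_le (hL : 3 ≤ L) (t' U β ν : ℝ) (N : ℕ)
    (p : Finset (Orb (FermionTorus 2 L)) → Prop) [DecidablePred p] [Nonempty {a // p a}]
    (hpN : ∀ s, p s → s.card = N)
    (hpΓ : ∀ s t, fockMapOp (d4Orb (DihedralGroup.r 1 : DihedralGroup 4)) s t ≠ 0 → (p s ↔ p t)) :
    (gibbsState β ((hubbardTorusTT' L 1 t' U).toBlock p p) ((kinOpTT' L t').toBlock p p)).re / 2 ≤
      ν * (N : ℝ) / 2 + ∑ k : TorusSite 2 L, ttBathtub t' ν k := by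
  have hL2 : 2 ≤ L := by omega
  have hHp : ((hubbardTorusTT' L 1 t' U).toBlock p p).IsHermitian :=
    (hubbardTorusTT'_isHermitian L 1 t' U).submatrix _
  have hZ : partitionFn β ((hubbardTorusTT' L 1 t' U).toBlock p p) ≠ 0 := fun h =>
    (partitionFn_re_pos hHp β).ne' (by rw [h, Complex.zero_re])
  -- Gibbs positivity on the compressed bathtub defect
  have h0 : 0 ≤ gibbsState β ((hubbardTorusTT' L 1 t' U).toBlock p p)
      ((((2 * ν : ℝ) : ℂ) • (totalNumber : Matrix (Finset (Orb (FermionTorus 2 L))) _ ℂ) +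
        ((4 * ∑ k : TorusSite 2 L, ttBathtub t' ν k : ℝ) : ℂ) •
          (1 : Matrix (Finset (Orb (FermionTorus 2 L))) _ ℂ) -
        (kinOpTT' L t' + fockMapOp (d4Orb (DihedralGroup.r 1 : DihedralGroup 4)) * kinOpTT' L t' *
          (fockMapOp (d4Orb (DihedralGroup.r 1 : DihedralGroup 4)))ᴴ)).toBlock p p) :=
    gibbsState_nonneg_of_posSemidef β hHp
      ((posSemidef_bathtubDefect hL2 t' ν).submatrix Subtype.val)
  -- expansion of the compression into blocks (entrywise `rfl`)
  have hexp : (((2 * ν : ℝ) : ℂ) • (totalNumber : Matrix (Finset (Orb (FermionTorus 2 L))) _ ℂ) +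
        ((4 * ∑ k : TorusSite 2 L, ttBathtub t' ν k : ℝ) : ℂ) •
          (1 : Matrix (Finset (Orb (FermionTorus 2 L))) _ ℂ) -
        (kinOpTT' L t' + fockMapOp (d4Orb (DihedralGroup.r 1 : DihedralGroup 4)) * kinOpTT' L t' *
          (fockMapOp (d4Orb (DihedralGroup.r 1 : DihedralGroup 4)))ᴴ)).toBlock p p =
      ((2 * ν : ℝ) : ℂ) •
          (totalNumber : Matrix (Finset (Orb (FermionTorus 2 L))) _ ℂ).toBlock p p +
        ((4 * ∑ k : TorusSite 2 L, ttBathtub t' ν k : ℝ) : ℂ) •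
          (1 : Matrix (Finset (Orb (FermionTorus 2 L))) _ ℂ).toBlock p p -
        ((kinOpTT' L t').toBlock p p +
          (fockMapOp (d4Orb (DihedralGroup.r 1 : DihedralGroup 4)) * kinOpTT' L t' *
            (fockMapOp (d4Orb (DihedralGroup.r 1 : DihedralGroup 4)))ᴴ).toBlock p p) := by
    ext i j
    rfl
  -- `N|_p = N · 1`
  have hNp : (totalNumber : Matrix (Finset (Orb (FermionTorus 2 L))) _ ℂ).toBlock p p =
      ((N : ℕ) : ℂ) • (1 : Matrix {a // p a} {a // p a} ℂ) := by
    ext i j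
    rw [toBlock_apply, totalNumber_eq_diagonal_card, Matrix.smul_apply, one_apply]
    simp only [diagonal, of_apply]
    by_cases h : i = j
    · subst h
      simp [hpN _ i.2]
    · have h' : (i : Finset (Orb (FermionTorus 2 L))) ≠ j := fun e => h (Subtype.ext e)
      simp [h, h']
  -- rotation invariance of the sector Gibbs state
  have hrot := gibbsState_toBlock_conj_of_sector p hpΓ fockMapOp_rot_mul_conjTranspose
    (fockMapOp_rot_mul_hubbardTorusTT' 1 t' U) β (kinOpTT' L t')
  rw [hexp, toBlock_one_self, hNp, map_sub, map_add, map_add, map_smul, map_smul, map_smul, hrot,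
    gibbsState_one β _ hZ] at h0
  have h1 := (Complex.nonneg_iff.1 h0).1
  simp only [smul_eq_mul, mul_one, Complex.sub_re, Complex.add_re, Complex.re_ofReal_mul,
    Complex.natCast_re, Complex.ofReal_re] at h1
  linarith

/-- **`ThermalKinWeightCeilingTT'` holds** (the canonical `(N_L, S^z = 0)` sector is non-empty,
consists of `N_L`-particle sets, and is respected by the rotation). -/
theorem thermalKinWeightCeilingTT'_holds : ThermalKinWeightCeilingTT' := by
  intro L _ hL t' U β δ hδ
  dsimp only
  intro ν
  haveI := nonempty_spinZeroSector (L := L) (NoGo.floor_pairNumber_le δ hδ L)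
  exact re_gibbsState_kinOpTT'_toBlock_le hL t' U β ν _ _ (fun s hs => hs.1)
    (fun s t h => sector_iff_of_fockMapOp_rot_ne_zero _ h)

/-- **`ThermalHalfBathtubStiffnessBoundTT'` holds**: bounds.tex Thm 1 at `T > 0` for the `t–t'`
torus in the canonical `(N_L, S^z = 0)` ensemble, fully machine-checked
(floor `thermalStiffnessTT'_mul_sq_le_kinetic` ∘ ceiling `thermalKinWeightCeilingTT'_holds`). -/
theorem thermalHalfBathtubStiffnessBoundTT'_holds : ThermalHalfBathtubStiffnessBoundTT' :=
  thermalHalfBathtubStiffnessBoundTT'_of_ceiling thermalKinWeightCeilingTT'_holds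

end Summit.HubbardSuperconductivity.HubbardLadder.Bounds
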